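import Summits.AtomisticToContinuum.Crystallization.Theorems.ChartedZeroExcessLayeredLatticeLiouvilleZZZYRCHA

/-!
# Charted zero-excess layered-lattice Liouville — ZZZYRCL: table domination SPLIT at a range `D` and the generic REMAINDER lemma (edition 1½)

Cell `decomp-a2c`, lens 2, generation 99.  The JS-D K-file proves `SchemeDominatedP` (ZZZYRCHA) box by box with tables of the form
«enumerated part (far pairs of length `≤ D`, finitely many classes, tabulated) + a uniform REMAINDER constant (pairs of length `> D`)».
This file supplies the two generic pieces that make that format a proof of `SchemeDominatedP`:

* `SchemeDominatedOnP ϱ α a b w np z P ΘR ΘN` — table domination restricted to the far pairs satisfying a class predicate `P`;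
  `schemeDominatedP_of_split` — domination on `{‖e‖ ≤ D}` with tables `Θ¹` and on `{D < ‖e‖}` with tables `Θ²` gives `SchemeDominatedP` with
  `Θ¹ + Θ²` (additivity of the partial sums, no sign condition); `SchemeDominatedP.mono` / `SchemeDominatedOnP.mono` (larger tables stay dominating);
* `norm_bondVec_le_of_pathSystem` — along a path system every far pair has `‖e_x‖ ≤ np x · ϱ` (telescoping), so pairs of length `> D` have
  `D / ϱ < np x` (`lt_np_of_pathSystem`);
* ★ `schemeDominatedOnP_remainder` — the REMAINDER LEMMA: if the paths are SIMPLE (no piece repeated), QUASI-GEODESIC in the weak form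
  «`n · a₋(‖e_x‖) ≤ g n` for every far pair with `np x = n ≥ nD`» (the K-file supplies `g n = n · a₋(c_p n)` from `c_p · np x ≤ ‖e_x‖` and the
  antitonicity of `a₋` beyond `√(26/7)`), have MULTIPLICITY `≤ M n` («at most `M n` far pairs with `np = n` route a piece through a given pair `y`»),
  every pair of length `> D` has `nD ≤ np x`, and the series is bounded, `Σ_{n ∈ [nD, N)} M n · g n ≤ θ` for all `N`, then on the class `{D < ‖e‖}`
  the constant tables `(1+α)·θ` and `(1+α⁻¹)·θ` dominate the scheme.  With `M n = C n⁴`, `g n = 7 n (c_p n)⁻⁸` the series is `7C c_p⁻⁸ Σ n⁻³`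
  (memo NODE-g99 §2(c): ≈ 7·10⁻⁵ at `D = 32` against the margin 0.017).

Theorem file (1 def, 9 theorems); imports ZZZYRCHA; no instance / notation / option; 0 sorry. [g99]
-/

open scoped BigOperators InnerProductSpace RealInnerProductSpace

namespace Summit.AtomisticToContinuum.Crystallization.Theorems.ChartedZeroExcessLayeredLatticeLiouville

open Summit.AtomisticToContinuum.Crystallization.Theorems.ChartedPlanarOrderRigidityDoor (E3)

/-! ### Restricted table domination and the split at a range -/

/-- **TABLE DOMINATION ON A CLASS** `SchemeDominatedOnP ϱ α a b w np z P ΘR ΘN`: the partial-sum domination of `SchemeDominatedP` asked only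
of finite sets of far pairs that satisfy the class predicate `P`. [g99] -/
def SchemeDominatedOnP (ϱ α : ℝ) (a b : E3) (w : ℤ → E3) (np : (Cell 2 × ℤ) × (Cell 2 × ℤ) → ℕ)
    (z : (Cell 2 × ℤ) × (Cell 2 × ℤ) → ℕ → Cell 2 × ℤ) (P : (Cell 2 × ℤ) × (Cell 2 × ℤ) → Prop)
    (ΘR ΘN : (Cell 2 × ℤ) × (Cell 2 × ℤ) → ℝ) : Prop :=
  ∀ X : Finset ((Cell 2 × ℤ) × (Cell 2 × ℤ)), (∀ x ∈ X, ϱ < ‖bondVec a b w x‖ ∧ P x) → ∀ y : (Cell 2 × ℤ) × (Cell 2 × ℤ),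
    (∑ x ∈ X, ∑ i ∈ Finset.range (np x), if piece z x i = y then schemeCoefR α a b w np z x i else 0) ≤ ΘR y ∧
      (∑ x ∈ X, ∑ i ∈ Finset.range (np x), if piece z x i = y then schemeCoefN α a b w np z x i else 0) ≤ ΘN y

/-- domination on the trivial class is `SchemeDominatedP`. [g99] -/
theorem schemeDominatedP_of_on_true {ϱ α : ℝ} {a b : E3} {w : ℤ → E3} {np : (Cell 2 × ℤ) × (Cell 2 × ℤ) → ℕ}
    {z : (Cell 2 × ℤ) × (Cell 2 × ℤ) → ℕ → Cell 2 × ℤ} {ΘR ΘN : (Cell 2 × ℤ) × (Cell 2 × ℤ) → ℝ}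
    (h : SchemeDominatedOnP ϱ α a b w np z (fun _ => True) ΘR ΘN) : SchemeDominatedP ϱ α a b w np z ΘR ΘN :=
  fun X hX y => h X (fun x hx => ⟨hX x hx, trivial⟩) y

/-- larger tables stay dominating (class form). [g99] -/
theorem SchemeDominatedOnP.mono {ϱ α : ℝ} {a b : E3} {w : ℤ → E3} {np : (Cell 2 × ℤ) × (Cell 2 × ℤ) → ℕ}
    {z : (Cell 2 × ℤ) × (Cell 2 × ℤ) → ℕ → Cell 2 × ℤ} {P : (Cell 2 × ℤ) × (Cell 2 × ℤ) → Prop}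
    {ΘR ΘN ΘR' ΘN' : (Cell 2 × ℤ) × (Cell 2 × ℤ) → ℝ} (hR : ∀ y, ΘR y ≤ ΘR' y) (hN : ∀ y, ΘN y ≤ ΘN' y)
    (h : SchemeDominatedOnP ϱ α a b w np z P ΘR ΘN) : SchemeDominatedOnP ϱ α a b w np z P ΘR' ΘN' :=
  fun X hX y => ⟨(h X hX y).1.trans (hR y), (h X hX y).2.trans (hN y)⟩

/-- larger tables stay dominating. [g99] -/
theorem SchemeDominatedP.mono {ϱ α : ℝ} {a b : E3} {w : ℤ → E3} {np : (Cell 2 × ℤ) × (Cell 2 × ℤ) → ℕ}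
    {z : (Cell 2 × ℤ) × (Cell 2 × ℤ) → ℕ → Cell 2 × ℤ} {ΘR ΘN ΘR' ΘN' : (Cell 2 × ℤ) × (Cell 2 × ℤ) → ℝ}
    (hR : ∀ y, ΘR y ≤ ΘR' y) (hN : ∀ y, ΘN y ≤ ΘN' y) (h : SchemeDominatedP ϱ α a b w np z ΘR ΘN) :
    SchemeDominatedP ϱ α a b w np z ΘR' ΘN' :=
  fun X hX y => ⟨(h X hX y).1.trans (hR y), (h X hX y).2.trans (hN y)⟩

/-- ★ **SPLIT AT A RANGE**: domination on the class `‖e‖ ≤ D` with tables `Θ¹` and on the class `D < ‖e‖` with tables `Θ²` gives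
`SchemeDominatedP` with the tables `Θ¹ + Θ²` (split every finite set of far pairs by the filter `‖e‖ ≤ D`; pure additivity). [g99] -/
theorem schemeDominatedP_of_split {ϱ α : ℝ} {a b : E3} {w : ℤ → E3} {np : (Cell 2 × ℤ) × (Cell 2 × ℤ) → ℕ}
    {z : (Cell 2 × ℤ) × (Cell 2 × ℤ) → ℕ → Cell 2 × ℤ} (D : ℝ) {ΘR₁ ΘN₁ ΘR₂ ΘN₂ : (Cell 2 × ℤ) × (Cell 2 × ℤ) → ℝ}
    (h₁ : SchemeDominatedOnP ϱ α a b w np z (fun x => ‖bondVec a b w x‖ ≤ D) ΘR₁ ΘN₁)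
    (h₂ : SchemeDominatedOnP ϱ α a b w np z (fun x => D < ‖bondVec a b w x‖) ΘR₂ ΘN₂) :
    SchemeDominatedP ϱ α a b w np z (fun y => ΘR₁ y + ΘR₂ y) (fun y => ΘN₁ y + ΘN₂ y) := by
  classical
  intro X hX y
  set X₁ := X.filter (fun x => ‖bondVec a b w x‖ ≤ D) with hX₁
  set X₂ := X.filter (fun x => ¬ ‖bondVec a b w x‖ ≤ D) with hX₂
  have hA₁ : ∀ x ∈ X₁, ϱ < ‖bondVec a b w x‖ ∧ ‖bondVec a b w x‖ ≤ D := fun x hx => by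
    rw [hX₁, Finset.mem_filter] at hx; exact ⟨hX x hx.1, hx.2⟩
  have hA₂ : ∀ x ∈ X₂, ϱ < ‖bondVec a b w x‖ ∧ D < ‖bondVec a b w x‖ := fun x hx => by
    rw [hX₂, Finset.mem_filter] at hx; exact ⟨hX x hx.1, lt_of_not_ge hx.2⟩
  obtain ⟨hR₁, hN₁⟩ := h₁ X₁ hA₁ y
  obtain ⟨hR₂, hN₂⟩ := h₂ X₂ hA₂ y
  constructor
  · rw [← Finset.sum_filter_add_sum_filter_not X (fun x => ‖bondVec a b w x‖ ≤ D)]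
    exact add_le_add hR₁ hR₂
  · rw [← Finset.sum_filter_add_sum_filter_not X (fun x => ‖bondVec a b w x‖ ≤ D)]
    exact add_le_add hN₁ hN₂

/-! ### Path length versus number of pieces -/

/-- the bond vector of a far pair telescopes along its path: `e_x = Σ_{i < np x} e_(piece i)`. [g99] -/
theorem bondVec_eq_sum_pieces {ϱ : ℝ} {a b : E3} {w : ℤ → E3} {np : (Cell 2 × ℤ) × (Cell 2 × ℤ) → ℕ}
    {z : (Cell 2 × ℤ) × (Cell 2 × ℤ) → ℕ → Cell 2 × ℤ} (hP : IsPathSystem ϱ a b w np z)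
    {x : (Cell 2 × ℤ) × (Cell 2 × ℤ)} (hx : ϱ < ‖bondVec a b w x‖) :
    bondVec a b w x = ∑ i ∈ Finset.range (np x), bondVec a b w (piece z x i) := by
  obtain ⟨h0, hn, -⟩ := hP x hx
  have htel : ∑ i ∈ Finset.range (np x), bondVec a b w (piece z x i) =
      lsite a b w (z x (np x)).1 (z x (np x)).2 - lsite a b w (z x 0).1 (z x 0).2 := by
    simpa [piece, bondVec] using Finset.sum_range_sub (fun i => lsite a b w (z x i).1 (z x i).2) (np x)
  rw [htel, h0, hn, bondVec]

/-- along a path system every far pair satisfies `‖e_x‖ ≤ np x · ϱ` (triangle inequality over the pieces of length `≤ ϱ`). [g99] -/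
theorem norm_bondVec_le_of_pathSystem {ϱ : ℝ} {a b : E3} {w : ℤ → E3} {np : (Cell 2 × ℤ) × (Cell 2 × ℤ) → ℕ}
    {z : (Cell 2 × ℤ) × (Cell 2 × ℤ) → ℕ → Cell 2 × ℤ} (hP : IsPathSystem ϱ a b w np z)
    {x : (Cell 2 × ℤ) × (Cell 2 × ℤ)} (hx : ϱ < ‖bondVec a b w x‖) : ‖bondVec a b w x‖ ≤ (np x : ℝ) * ϱ := by
  obtain ⟨-, -, hpc⟩ := hP x hx
  rw [bondVec_eq_sum_pieces hP hx]
  calc ‖∑ i ∈ Finset.range (np x), bondVec a b w (piece z x i)‖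
      ≤ ∑ i ∈ Finset.range (np x), ‖bondVec a b w (piece z x i)‖ := norm_sum_le _ _
    _ ≤ ∑ i ∈ Finset.range (np x), ϱ := Finset.sum_le_sum fun i hi => (hpc i (Finset.mem_range.mp hi)).2
    _ = (np x : ℝ) * ϱ := by rw [Finset.sum_const, Finset.card_range, nsmul_eq_mul]

/-- a far pair of length `> D` has more than `D / ϱ` pieces. [g99] -/
theorem lt_np_of_pathSystem {ϱ D : ℝ} (hϱ : 0 < ϱ) {a b : E3} {w : ℤ → E3} {np : (Cell 2 × ℤ) × (Cell 2 × ℤ) → ℕ}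
    {z : (Cell 2 × ℤ) × (Cell 2 × ℤ) → ℕ → Cell 2 × ℤ} (hP : IsPathSystem ϱ a b w np z)
    {x : (Cell 2 × ℤ) × (Cell 2 × ℤ)} (hx : ϱ < ‖bondVec a b w x‖) (hD : D < ‖bondVec a b w x‖) : D / ϱ < (np x : ℝ) := by
  rw [div_lt_iff₀ hϱ]
  exact hD.trans_le (norm_bondVec_le_of_pathSystem hP hx)

/-! ### The remainder lemma -/

/-- one path contributes at most `n · a₋(‖e_x‖)` (times `1+α`, resp. `1+α⁻¹`) to the table entry of a pair `y` it passes through, and nothing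
to a pair it does not pass through — for SIMPLE paths (no piece repeated). [g99] -/
theorem path_sum_ite_le {α : ℝ} (hα : 0 < α) {a b : E3} {w : ℤ → E3} {np : (Cell 2 × ℤ) × (Cell 2 × ℤ) → ℕ}
    {z : (Cell 2 × ℤ) × (Cell 2 × ℤ) → ℕ → Cell 2 × ℤ} {x y : (Cell 2 × ℤ) × (Cell 2 × ℤ)}
    (hsimple : ∀ i j, i < np x → j < np x → piece z x i = piece z x j → i = j) :
    (∑ i ∈ Finset.range (np x), if piece z x i = y then schemeCoefR α a b w np z x i else 0) ≤
        (if ∃ i < np x, piece z x i = y then (1 + α) * ((np x : ℝ) * aMinus ‖bondVec a b w x‖) else 0) ∧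
      (∑ i ∈ Finset.range (np x), if piece z x i = y then schemeCoefN α a b w np z x i else 0) ≤
        (if ∃ i < np x, piece z x i = y then (1 + α⁻¹) * ((np x : ℝ) * aMinus ‖bondVec a b w x‖) else 0) := by
  classical
  have hα1 : 0 ≤ 1 + α := by linarith
  have hα2 : 0 ≤ 1 + α⁻¹ := by positivity
  -- coefficient bounds: cos² ≤ 1 and sin² ≤ 1
  have hA := aMinus_nonneg ‖bondVec a b w x‖
  have hn := Nat.cast_nonneg (α := ℝ) (np x)
  have hcR : ∀ i, schemeCoefR α a b w np z x i ≤ (1 + α) * ((np x : ℝ) * aMinus ‖bondVec a b w x‖) := fun i => by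
    unfold schemeCoefR
    calc (1 + α) * (np x : ℝ) * cosSq a b w z x i * aMinus ‖bondVec a b w x‖
        ≤ (1 + α) * (np x : ℝ) * 1 * aMinus ‖bondVec a b w x‖ :=
          mul_le_mul_of_nonneg_right (mul_le_mul_of_nonneg_left (cosSq_le_one a b w z x i) (mul_nonneg hα1 hn)) hA
      _ = (1 + α) * ((np x : ℝ) * aMinus ‖bondVec a b w x‖) := by ring
  have hcN : ∀ i, schemeCoefN α a b w np z x i ≤ (1 + α⁻¹) * ((np x : ℝ) * aMinus ‖bondVec a b w x‖) := fun i => by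
    unfold schemeCoefN
    have h3 : 1 - cosSq a b w z x i ≤ 1 := by linarith [cosSq_nonneg a b w z x i]
    calc (1 + α⁻¹) * (np x : ℝ) * (1 - cosSq a b w z x i) * aMinus ‖bondVec a b w x‖
        ≤ (1 + α⁻¹) * (np x : ℝ) * 1 * aMinus ‖bondVec a b w x‖ :=
          mul_le_mul_of_nonneg_right (mul_le_mul_of_nonneg_left h3 (mul_nonneg hα2 hn)) hA
      _ = (1 + α⁻¹) * ((np x : ℝ) * aMinus ‖bondVec a b w x‖) := by ring
  by_cases hex : ∃ i < np x, piece z x i = y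
  · rw [if_pos hex, if_pos hex]
    obtain ⟨i₀, hi₀, hy₀⟩ := hex
    -- the filter of indices hitting `y` is the singleton `{i₀}`
    have hfilt : (Finset.range (np x)).filter (fun i => piece z x i = y) = {i₀} := by
      ext i
      simp only [Finset.mem_filter, Finset.mem_range, Finset.mem_singleton]
      constructor
      · rintro ⟨hi, hy⟩; exact hsimple i i₀ hi hi₀ (hy.trans hy₀.symm)
      · rintro rfl; exact ⟨hi₀, hy₀⟩
    constructor
    · rw [← Finset.sum_filter, hfilt, Finset.sum_singleton]; exact hcR i₀
    · rw [← Finset.sum_filter, hfilt, Finset.sum_singleton]; exact hcN i₀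
  · rw [if_neg hex, if_neg hex]
    have hex' : ∀ i, i < np x → piece z x i ≠ y := fun i hi h => hex ⟨i, hi, h⟩
    have hzR : ∀ i ∈ Finset.range (np x), (if piece z x i = y then schemeCoefR α a b w np z x i else 0) = 0 := fun i hi => by
      rw [if_neg (hex' i (Finset.mem_range.mp hi))]
    have hzN : ∀ i ∈ Finset.range (np x), (if piece z x i = y then schemeCoefN α a b w np z x i else 0) = 0 := fun i hi => by
      rw [if_neg (hex' i (Finset.mem_range.mp hi))]
    exact ⟨(Finset.sum_eq_zero hzR).le, (Finset.sum_eq_zero hzN).le⟩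

/-- ★★ **THE REMAINDER LEMMA** (edition 1½ of the truncation, memo NODE-g99 §2(c)): on the class of far pairs of length `> D` the CONSTANT tables
`(1+α)·θ`, `(1+α⁻¹)·θ` dominate the scheme, provided the paths are simple, every such pair has `nD ≤ np x`, the weak quasi-geodesic bound
`np x · a₋(‖e_x‖) ≤ g (np x)` holds, at most `M n` far pairs with `np = n` of any finite family route a piece through a given pair, `0 ≤ g`, and the
partial sums `Σ_{n ∈ [nD, N)} M n · g n ≤ θ` are bounded.  (Group the far pairs by `np`; per group `≤ g n · M n`; sum the series.) [g99] -/
theorem schemeDominatedOnP_remainder {ϱ α D θ : ℝ} (hα : 0 < α) {a b : E3} {w : ℤ → E3}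
    {np : (Cell 2 × ℤ) × (Cell 2 × ℤ) → ℕ} {z : (Cell 2 × ℤ) × (Cell 2 × ℤ) → ℕ → Cell 2 × ℤ} {nD : ℕ} {g M : ℕ → ℝ}
    (hsimple : ∀ x, ϱ < ‖bondVec a b w x‖ → ∀ i j, i < np x → j < np x → piece z x i = piece z x j → i = j)
    (hnD : ∀ x, ϱ < ‖bondVec a b w x‖ → D < ‖bondVec a b w x‖ → nD ≤ np x)
    (hg : ∀ x, ϱ < ‖bondVec a b w x‖ → D < ‖bondVec a b w x‖ → (np x : ℝ) * aMinus ‖bondVec a b w x‖ ≤ g (np x))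
    (hg0 : ∀ n, 0 ≤ g n)
    (hM : ∀ (y : (Cell 2 × ℤ) × (Cell 2 × ℤ)) (n : ℕ) (Y : Finset ((Cell 2 × ℤ) × (Cell 2 × ℤ))),
      (∀ x ∈ Y, ϱ < ‖bondVec a b w x‖ ∧ D < ‖bondVec a b w x‖ ∧ np x = n ∧ ∃ i < np x, piece z x i = y) → (Y.card : ℝ) ≤ M n)
    (hθ : ∀ N : ℕ, ∑ n ∈ Finset.Ico nD N, M n * g n ≤ θ) :
    SchemeDominatedOnP ϱ α a b w np z (fun x => D < ‖bondVec a b w x‖) (fun _ => (1 + α) * θ) (fun _ => (1 + α⁻¹) * θ) := by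
  classical
  intro X hX y
  -- the core estimate, uniform in the prefactor `c ∈ {1+α, 1+α⁻¹}`
  have core : ∀ c : ℝ, 0 ≤ c →
      (∑ x ∈ X, if ∃ i < np x, piece z x i = y then c * ((np x : ℝ) * aMinus ‖bondVec a b w x‖) else 0) ≤ c * θ := by
    intro c hc
    -- restrict to the pairs routed through `y`
    set Y := X.filter (fun x => ∃ i < np x, piece z x i = y) with hY
    have hstep1 : (∑ x ∈ X, if ∃ i < np x, piece z x i = y then c * ((np x : ℝ) * aMinus ‖bondVec a b w x‖) else 0) =
        ∑ x ∈ Y, c * ((np x : ℝ) * aMinus ‖bondVec a b w x‖) := by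
      rw [hY, Finset.sum_filter]
    rw [hstep1, ← Finset.mul_sum]
    refine mul_le_mul_of_nonneg_left ?_ hc
    have hYmem : ∀ x ∈ Y, ϱ < ‖bondVec a b w x‖ ∧ D < ‖bondVec a b w x‖ ∧ ∃ i < np x, piece z x i = y := fun x hx => by
      rw [hY, Finset.mem_filter] at hx; exact ⟨(hX x hx.1).1, (hX x hx.1).2, hx.2⟩
    -- group by the number of pieces
    set N := Y.sup np + 1 with hN
    have hmaps : ∀ x ∈ Y, np x ∈ Finset.Ico nD N := fun x hx => by
      rw [Finset.mem_Ico]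
      exact ⟨hnD x (hYmem x hx).1 (hYmem x hx).2.1, Nat.lt_succ_of_le (Finset.le_sup hx)⟩
    rw [← Finset.sum_fiberwise_of_maps_to hmaps]
    refine (Finset.sum_le_sum fun n hn => ?_).trans (hθ N)
    -- the fibre `np = n`: each term ≤ g n, and at most M n terms
    have hfib : ∀ x ∈ Y.filter (fun x => np x = n), (np x : ℝ) * aMinus ‖bondVec a b w x‖ ≤ g n := fun x hx => by
      rw [Finset.mem_filter] at hx
      rw [← hx.2]; exact hg x (hYmem x hx.1).1 (hYmem x hx.1).2.1
    have hcard : ((Y.filter (fun x => np x = n)).card : ℝ) ≤ M n :=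
      hM y n _ fun x hx => by
        rw [Finset.mem_filter] at hx
        exact ⟨(hYmem x hx.1).1, (hYmem x hx.1).2.1, hx.2, (hYmem x hx.1).2.2⟩
    calc ∑ x ∈ Y.filter (fun x => np x = n), (np x : ℝ) * aMinus ‖bondVec a b w x‖
        ≤ ∑ x ∈ Y.filter (fun x => np x = n), g n := Finset.sum_le_sum hfib
      _ = ((Y.filter (fun x => np x = n)).card : ℝ) * g n := by rw [Finset.sum_const, nsmul_eq_mul]
      _ ≤ M n * g n := mul_le_mul_of_nonneg_right hcard (hg0 n)
  have hα1 : 0 ≤ 1 + α := by linarith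
  have hα2 : 0 ≤ 1 + α⁻¹ := by positivity
  constructor
  · refine (Finset.sum_le_sum fun x hx => (path_sum_ite_le hα (hsimple x (hX x hx).1)).1).trans (core _ hα1)
  · refine (Finset.sum_le_sum fun x hx => (path_sum_ite_le hα (hsimple x (hX x hx).1)).2).trans (core _ hα2)

end Summit.AtomisticToContinuum.Crystallization.Theorems.ChartedZeroExcessLayeredLatticeLiouville
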